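import Literature.Computability.QuantumComplexity.NonlocalGameClassicalValue
import Mathlib.Data.ZMod.Basic
import Mathlib.Algebra.BigOperators.Field
import HarnessLib

/-!
# The Odd Cycle game: `ω_c = 1 − 1/2n`

Topic `Literature/Computability/QuantumComplexity`, a companion of `NonlocalGameClassicalValue.lean`
(`NonlocalGame`, `detValue`, `classicalValue`, `mixedValue_le_classicalValue`, `chsh`) and
`MagicSquareGame.lean`.  Source (held text `paper:arxiv-quant-ph_0404076`, read at the cited
place):

* R. Cleve, P. Høyer, B. Toner, J. Watrous, *Consequences and limits of nonlocal strategies*,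
  CCC 2004 = arXiv:quant-ph/0404076 [CleveEtAl2004], §3.2 (The Odd Cycle game): “imagine that
  Alice and Bob are trying to convince the referee that an odd cycle of length n is 2-colorable
  (which it is not, as n is odd). The referee sends the name of a vertex to each of Alice and Bob
  such that the two vertices are either the same or adjacent. … when the vertices are the same,
  the two colors should agree, and when the vertices are adjacent, the colors should be
  different. Formally, let n ≥ 3 be an odd integer, let S = T = ℤ_n, and let A = B = {0,1}. Take
  π to be the uniform distribution over the set {(s,t) ∈ ℤ_n × ℤ_n : s = t or s + 1 ≡ t (mod n)}
  and let V be defined as V(a,b|s,t) = 1 if a ⊕ b = [s + 1 ≡ t (mod n)], 0 otherwise. … This is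
  a variation on a game based on the chained Bell inequalities of Braunstein and Caves … It is
  easy to see that ω_c(G) = 1 − 1/2n for this game. Any deterministic strategy must fail for at
  least one of the possible pairs (s,t), as an odd cycle cannot be 2-colored, while a strategy
  achieving success probability 1 − 1/2n is that Alice and Bob let a = s mod 2 and b = t mod 2.”

HONEST FRAMING (pub-qadeq lane — nonlocal-game ∕ chained-Bell benchmarks read against classical
values, rows E-76 / E-78): instance-level adjudication of specific advantage claims; no claim
about BQP vs BPP or the summit.  This file certifies the CLASSICAL value only; the quantum
strategy of value `cos²(π/4n)` and its optimality (CHTW Corollary 10) are NOT formalised here.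

## Contents (all proved, 0 named facts)

* `OddCycle.win`, **`oddCycle n : NonlocalGame (ZMod n) (ZMod n) Bool Bool`** (`π = 1/2n` on the
  `2n` pairs `(s,s)`, `(s,s+1)`; `OddCycle.supp`, `card_supp`), `detValue_eq` (`= #wins / 2n`).
* **`exists_loss`** (odd `n ≥ 3`: every deterministic strategy loses an in-support pair — a
  perfect one would 2-colour the odd cycle, `alternate`), `card_winSet_le` (`≤ 2n − 1`),
  **`detValue_le`** (`≤ 1 − 1/2n`).
* `parityStrategy` (`s ↦ s mod 2`), **`winSet_parity`** (it loses exactly the wrap-around edge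
  `(n − 1, 0)`), `detValue_parity` (`= 1 − 1/2n`), and
  **`classicalValue_oddCycle : (oddCycle n).classicalValue = 1 − 1/2n`** for odd `n ≥ 3`.

## Mathlib / tree search

Mathlib: no nonlocal games.  Tree: `NonlocalGameClassicalValue.lean` has the general
graph-colouring game `coloringGame G c` with BOTH edge orientations as questions (`|V| + 2|E|`
questions, every deterministic strategy loses `≥ 2` of them when `G` is not `c`-colourable); the
CHTW odd-cycle game asks only the forward edge `(s, s+1)` (`2n` questions, `≥ 1` loss), so its
value `1 − 1/2n` is certified here directly on `ZMod n` rather than as an instance of that file.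
-/

namespace Literature.Computability.QuantumComplexity

open Finset

namespace OddCycle

/-- The predicate of the Odd Cycle game: `V(a,b|s,t) = 1` iff `a ⊕ b = [s + 1 ≡ t (mod n)]`.
[cite: CleveEtAl2004, §3.2] -/
def win {n : ℕ} (s t : ZMod n) (a b : Bool) : Bool := (xor a b) == decide (t = s + 1)

end OddCycle

/-- **The Odd Cycle game** on `ℤ_n`: `S = T = ℤ_n`, `A = B = {0,1}`, `π` uniform on the `2n` pairs
`{(s,t) : s = t or s + 1 ≡ t (mod n)}`, and `V(a,b|s,t) = 1` iff `a ⊕ b = [s + 1 ≡ t (mod n)]`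
(“when the vertices are the same, the two colors should agree, and when the vertices are adjacent,
the colors should be different”). [cite: CleveEtAl2004, §3.2] -/
noncomputable def oddCycle (n : ℕ) [NeZero n] : NonlocalGame (ZMod n) (ZMod n) Bool Bool where
  prior s t := if t = s ∨ t = s + 1 then 1 / (2 * n) else 0
  prior_nonneg s t := by split_ifs <;> positivity
  win := OddCycle.win

namespace OddCycle

variable {n : ℕ}

/-- `1 ≠ 0` in `ℤ_n` for `n ≥ 2`. [folklore] -/
private theorem one_ne_zero' (hn : 2 ≤ n) : (1 : ZMod n) ≠ 0 := by
  haveI : Fact (1 < n) := ⟨hn⟩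
  exact one_ne_zero

/-- Along a perfect strategy Bob's colour would alternate around the cycle:
`b(s + k) = b(s) ⊕ [k odd]`. [cite: CleveEtAl2004, §3.2 (“an odd cycle cannot be 2-colored”)] -/
private theorem alternate {b : ZMod n → Bool} (h : ∀ s, b (s + 1) = !b s) (s : ZMod n) :
    ∀ k : ℕ, b (s + k) = xor (b s) (decide (k % 2 = 1))
  | 0 => by simp
  | k + 1 => by
    rw [Nat.cast_succ, ← add_assoc, h, alternate h s k]
    rcases Nat.mod_two_eq_zero_or_one k with hk | hk <;>
      cases b s <;> simp [hk, Nat.succ_mod_two_eq_one_iff]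

variable [NeZero n]

/-- The support of `π`: the `2n` pairs `(s, s)` and `(s, s+1)`. [cite: CleveEtAl2004, §3.2] -/
def supp (n : ℕ) [NeZero n] : Finset (ZMod n × ZMod n) :=
  univ.filter fun st => st.2 = st.1 ∨ st.2 = st.1 + 1

/-- The winning in-support pairs of a deterministic strategy. [cite: CleveEtAl2004, §3.2] -/
def winSet (a b : ZMod n → Bool) : Finset (ZMod n × ZMod n) :=
  univ.filter fun st => (st.2 = st.1 ∨ st.2 = st.1 + 1) ∧ win st.1 st.2 (a st.1) (b st.2) = true

/-- The support has `2n` elements (`n ≥ 2`). [cite: CleveEtAl2004, §3.2] -/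
theorem card_supp (hn : 2 ≤ n) : (supp n).card = 2 * n := by
  have h1 := one_ne_zero' (n := n) hn
  have hsupp : supp n =
      (univ.image fun s : ZMod n => (s, s)) ∪ (univ.image fun s : ZMod n => (s, s + 1)) := by
    ext ⟨s, t⟩
    simp only [supp, mem_filter, mem_univ, true_and, mem_union, mem_image, Prod.mk.injEq]
    constructor
    · rintro (h | h)
      · exact Or.inl ⟨s, rfl, h.symm⟩
      · exact Or.inr ⟨s, rfl, h.symm⟩
    · rintro (⟨x, hx, hxt⟩ | ⟨x, hx, hxt⟩)
      · exact Or.inl (by rw [← hxt, hx])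
      · exact Or.inr (by rw [← hxt, hx])
  rw [hsupp, card_union_of_disjoint, card_image_of_injective _ fun x y h => (Prod.mk.inj h).1,
    card_image_of_injective _ fun x y h => (Prod.mk.inj h).1, card_univ, ZMod.card, two_mul]
  rw [disjoint_left]
  rintro ⟨s, t⟩ h h'
  simp only [mem_image, mem_univ, true_and, Prod.mk.injEq] at h h'
  obtain ⟨x, rfl, rfl⟩ := h
  obtain ⟨y, rfl, hy⟩ := h'
  exact h1 (by simpa using hy)

/-- The value of a deterministic strategy is `#wins / 2n`. [cite: CleveEtAl2004, §2, §3.2] -/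
theorem detValue_eq (a b : ZMod n → Bool) :
    (oddCycle n).detValue a b = (winSet a b).card / (2 * n) := by
  unfold NonlocalGame.detValue
  have h : ∀ s t, (oddCycle n).prior s t * (if (oddCycle n).win s t (a s) (b t) then (1 : ℝ) else 0)
      = (if (t = s ∨ t = s + 1) ∧ win s t (a s) (b t) = true then (1 : ℝ) else 0) / (2 * n) := by
    intro s t
    simp only [oddCycle]
    split_ifs <;> simp_all
  simp_rw [h]
  rw [← Fintype.sum_prod_type' (f := fun s t =>
    (if (t = s ∨ t = s + 1) ∧ win s t (a s) (b t) = true then (1 : ℝ) else 0) / (2 * n)),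
    ← Finset.sum_div, Finset.sum_boole]
  rfl

/-- **Every deterministic strategy loses an in-support pair** when `n ≥ 3` is odd (“Any
deterministic strategy must fail for at least one of the possible pairs (s,t), as an odd cycle
cannot be 2-colored”). [cite: CleveEtAl2004, §3.2] -/
theorem exists_loss (hodd : Odd n) (hn : 3 ≤ n) (a b : ZMod n → Bool) :
    ∃ s t, (t = s ∨ t = s + 1) ∧ win s t (a s) (b t) = false := by
  have h1 := one_ne_zero' (n := n) (by omega)
  by_contra h
  push Not at h
  have h' : ∀ s t, (t = s ∨ t = s + 1) → win s t (a s) (b t) = true := fun s t hst => by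
    simpa using h s t hst
  -- same vertex: colours agree; adjacent vertices: colours differ
  have hsame : ∀ s, a s = b s := fun s => by
    have := h' s s (Or.inl rfl)
    have hs : ¬ (s = s + 1) := fun e => h1 (by simpa using e.symm)
    simpa [win, hs] using this
  have hadj : ∀ s, b (s + 1) = !b s := fun s => by
    have := h' s (s + 1) (Or.inr rfl)
    rw [← hsame s]
    revert this
    simp only [win, decide_true, beq_true]
    cases a s <;> cases b (s + 1) <;> simp
  -- once around the odd cycle: b(0 + n) = b(0) ⊕ 1, but 0 + n = 0
  have key := alternate hadj 0 n
  rw [ZMod.natCast_self, add_zero, Nat.odd_iff.mp hodd] at key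
  revert key; cases b 0 <;> simp

/-- Hence at most `2n − 1` in-support pairs are won … [cite: CleveEtAl2004, §3.2] -/
theorem card_winSet_le (hodd : Odd n) (hn : 3 ≤ n) (a b : ZMod n → Bool) :
    (winSet a b).card ≤ 2 * n - 1 := by
  obtain ⟨s, t, hst, hlose⟩ := exists_loss hodd hn a b
  have hsub : winSet a b ⊆ (supp n).erase (s, t) := by
    intro x hx
    simp only [winSet, mem_filter, mem_univ, true_and] at hx
    refine mem_erase.mpr ⟨?_, by simp [supp, hx.1]⟩
    rintro rfl
    exact absurd hx.2 (by simp [hlose])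
  have := card_le_card hsub
  rwa [card_erase_of_mem (by simp [supp, hst]), card_supp (by omega)] at this

/-- … and every deterministic strategy has value at most `1 − 1/2n`. [cite: CleveEtAl2004, §3.2] -/
theorem detValue_le (hodd : Odd n) (hn : 3 ≤ n) (a b : ZMod n → Bool) :
    (oddCycle n).detValue a b ≤ 1 - 1 / (2 * n) := by
  rw [detValue_eq]
  have hc := card_winSet_le hodd hn a b
  have hn' : (0 : ℝ) < 2 * n := by positivity
  have : ((winSet a b).card : ℝ) ≤ 2 * n - 1 := by
    have : ((winSet a b).card : ℝ) ≤ ((2 * n - 1 : ℕ) : ℝ) := by exact_mod_cast hc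
    rw [Nat.cast_sub (by omega)] at this; push_cast at this; linarith
  rw [div_le_iff₀ hn', sub_mul, one_mul, div_mul_cancel₀ _ hn'.ne']
  exact this

/-- The parity strategy `a = s mod 2`, `b = t mod 2`. [cite: CleveEtAl2004, §3.2 (“Alice and Bob
let a = s mod 2 and b = t mod 2”)] -/
def parityStrategy (s : ZMod n) : Bool := decide (s.val % 2 = 1)

/-- The parity strategy wins every in-support pair except the wrap-around edge `(n − 1, 0)`.
[cite: CleveEtAl2004, §3.2] -/
theorem winSet_parity (hodd : Odd n) (hn : 3 ≤ n) :
    winSet (n := n) parityStrategy parityStrategy = (supp n).erase (-1, 0) := by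
  haveI : Fact (1 < n) := ⟨by omega⟩
  have h1 : (1 : ZMod n) ≠ 0 := one_ne_zero
  ext ⟨s, t⟩
  simp only [winSet, supp, mem_filter, mem_univ, true_and, mem_erase, ne_eq, Prod.mk.injEq]
  constructor
  · rintro ⟨hst, hwin⟩
    refine ⟨?_, hst⟩
    rintro ⟨hs, ht⟩
    rw [hs, ht] at hwin
    -- the wrap-around edge loses: (n − 1) mod 2 = 0 = 0 mod 2 although the colours must differ
    have hv : (-1 : ZMod n).val = n - 1 := by
      rw [ZMod.neg_val, ZMod.val_one, if_neg h1]
    have hpar : ¬ ((n - 1) % 2 = 1) := by have := Nat.odd_iff.mp hodd; omega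
    simp [win, parityStrategy, hv, hpar, ZMod.val_zero] at hwin
  · rintro ⟨hne, hst⟩
    refine ⟨hst, ?_⟩
    rcases hst with ht | ht
    · rw [ht]
      have hs : ¬ (s = s + 1) := fun e => h1 (by simpa using e.symm)
      simp [win, hs]
    · rw [ht]
      -- an ordinary edge: consecutive residues have different parities
      have hs : s ≠ -1 := fun e => hne ⟨e, by rw [ht, e, neg_add_cancel]⟩
      have hval : (s + 1).val = s.val + 1 := by
        rw [ZMod.val_add, ZMod.val_one, Nat.mod_eq_of_lt]
        have := ZMod.val_lt s
        rcases Nat.lt_or_ge (s.val + 1) n with h | h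
        · exact h
        · exfalso; apply hs
          have hsv : s.val = n - 1 := by omega
          have e : s = ((n - 1 : ℕ) : ZMod n) := by rw [← hsv, ZMod.natCast_zmod_val]
          rw [e, Nat.cast_sub (by omega), ZMod.natCast_self, Nat.cast_one, zero_sub]
      simp only [win, parityStrategy, hval, decide_true, beq_true]
      rcases Nat.mod_two_eq_zero_or_one s.val with h | h <;>
        simp [h, Nat.succ_mod_two_eq_one_iff]

/-- The parity strategy has value exactly `1 − 1/2n`. [cite: CleveEtAl2004, §3.2] -/
theorem detValue_parity (hodd : Odd n) (hn : 3 ≤ n) :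
    (oddCycle n).detValue parityStrategy parityStrategy = 1 - 1 / (2 * n) := by
  rw [detValue_eq, winSet_parity hodd hn, card_erase_of_mem (by simp [supp]), card_supp (by omega)]
  have hn' : (2 * n : ℝ) ≠ 0 := by positivity
  rw [Nat.cast_sub (by omega)]
  push_cast
  rw [sub_div, div_self hn']

end OddCycle

/-- **`ω_c(G) = 1 − 1/2n` for the Odd Cycle game** (`n ≥ 3` odd). [cite: CleveEtAl2004, §3.2
(“It is easy to see that ω_c(G) = 1 − 1/2n for this game”)] -/
theorem classicalValue_oddCycle {n : ℕ} [NeZero n] (hodd : Odd n) (hn : 3 ≤ n) :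
    (oddCycle n).classicalValue = 1 - 1 / (2 * n) :=
  le_antisymm (NonlocalGame.classicalValue_le (OddCycle.detValue_le hodd hn))
    (OddCycle.detValue_parity hodd hn ▸ (oddCycle n).detValue_le_classicalValue _ _)

end Literature.Computability.QuantumComplexity
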